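import Literature.Analysis.FluidPDE.CKNLocalEnergyEstimate
import Literature.Analysis.FluidPDE.CKNPressureEstimate
import HarnessLib

/-!
# The absolute local-energy bound at two scales (Lemarié-Rieusset, proof of Thm. 14.4, p. 506)

Analysis/FluidPDE support file (everything proved, no definitions, no named facts) in the
decomposition of the named fact `Literature.Analysis.FluidPDE.lemarieRieusset_lemma_14_2`
(`CKNEpsilonRegularityProofs.lean`: P. G. Lemarié-Rieusset, *The Navier–Stokes Problem in the
21st Century*, §14.3, Lemma 14.2 — the one-scale smallness of `∫∫ (|u|³ + |p|^{3/2})` and of the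
force propagates to all points and scales).

The first step of the printed proof (scan p. 506, the display following the choice of
Scheffer's test function `ψ(s,y) = r³ ω((s-t)/ρ², (y-x)/ρ) θ((s-t)/r²) W_{ν(r²+t-s)}(x-y)` in
the sliced local energy inequality (14.18)) is the bound

  `max(U_r, 2ν V_r) ≤ C ∬_{Q_ρ} (r³/ρ⁵) |u|² + C ∬_{Q_ρ} r⁻¹ |u|³ + C ∬_{Q_ρ} r⁻¹ |p|^{3/2}
     + C r^{1/2} ∬_{Q_ρ} |f|^{3/2}`,     `0 < r ≤ ρ/2`,

in which — unlike Robinson–Rodrigo–Sadowski's (16.6)/(16.13) (the tree's `localEnergy_master`,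
`localEnergyEstimate`) — the cubic term `∬ |u|² u·∇ψ` is bounded *crudely* by `r⁻¹ ∬ |u|³`, with
no mean subtracted, so that **no energy quantity of the large cylinder appears on the right**.
This is what allows the bound to *initialise* an iteration from the hypotheses of Lemma 14.2
(which control `∬ |u|³`, `∬ |p|^{3/2}`, `∬ |f|^q` only).

This file proves that bound in the tree's scaled vocabulary (`A = cknAEss`, `E = cknE`,
`C = cknC`, `D = cknD`, `F_q = cknF`, backward cylinders `Q_r(z)`), before Young's inequality
(the four raw Hölder terms, as in `localEnergy_master`):

* `localEnergyBound_master` — unit scale, raw form: for a suitable weak solution with viscosity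
  `ν > 0` and force `f ∈ L^q`, `q ≥ 3/2`, around `closure Q₁(0)`, with `A(1), E(1), C(1), D(1),
  F_q(1)` finite, and `0 < θ ≤ 1/2`,
  `A(θ) + E(θ) ≤ c_ν [c_T θ² c₁ C(1)^{2/3} + c_T θ⁻² C(1) + 2c_T θ⁻² D(1)^{2/3} C(1)^{1/3}
     + 2 c_T c₂ θ⁻¹ F_q(1)^{1/q} C(1)^{1/3}]`, `c_ν = (1 + (2ν)⁻¹) c_T`;
* `localEnergyBound_unitScale` — the same without finiteness hypotheses (they follow from
  `closure Q₁(0) ⊆ Q`, the interpolation inequality and `f ∈ L^q(Q)`);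
* `localEnergyBound` — every centre and scale, by the Navier–Stokes scaling
  (as `localEnergyEstimate_of_unitScale`): for `closure Q_R(z) ⊆ Q`, `0 < θ ≤ 1/2`,
  `A(θR) + E(θR) ≤ c₁ θ² C(R)^{2/3} + c₂ θ⁻² C(R) + c₃ θ⁻² D(R)^{2/3} C(R)^{1/3}
     + c₄ θ⁻¹ F_q(R)^{1/q} C(R)^{1/3}` with constants depending only on `ν`.

The proof is that of `localEnergy_master` (`CKNLocalEnergyEstimate.lean`: Scheffer's localised
backward heat kernel `Scheffer.testFn ν θ 1 0 0`, the sliced local energy inequality with time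
cut-offs `ae_localEnergy_slice_cutoff`, the dominating function, the essential supremum for
`A(θ)` and the exhaustion `setLIntegral_le_of_ae_neg_time` for `E(θ)`), with the mean-zero
device removed: the integrand `(|u|² + 2p) u·∇ψ` is bounded pointwise by
`(|u|³ + 2|p||u|) |∇ψ|`, so the divergence-free slices are not used.

## References

* P. G. Lemarié-Rieusset, *The Navier–Stokes Problem in the 21st Century*, 2nd ed., CRC Press,
  §14.3, proof of Thm. 14.4, (14.18) and the display preceding (14.19) (scan p. 506).
  [Lemarierieusset2023]
* J. C. Robinson, J. L. Rodrigo, W. Sadowski, *The three-dimensional Navier–Stokes equations*,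
  CUP (2016), proof of Thm. 15.3 Step 2 (15.23) and proof of Thm. 16.1 (16.6).
  [RobinsonRodrigoSadowski2016]
* L. Caffarelli, R. Kohn, L. Nirenberg, *Partial regularity of suitable weak solutions of the
  Navier–Stokes equations*, Comm. Pure Appl. Math. 35 (1982), §2 (2.5) and Lemma 5.1.
  [CaffarelliKohnNirenberg1982]
-/

noncomputable section

open MeasureTheory Set Function Filter Topology TopologicalSpace Metric Module
open scoped NNReal ENNReal InnerProductSpace RealInnerProductSpace Laplacian

namespace Literature.Analysis.FluidPDE

/-! ### Pointwise bounds for the right-hand side (crude cubic term) -/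

section RHS

variable {E : Type*} [NormedAddCommGroup E] [InnerProductSpace ℝ E]

/-- **Pointwise bound of the right-hand integrand, cubic term not mean-subtracted**
(Lemarié-Rieusset, p. 506: the terms `∬ r⁻¹|u|³`, `∬ r⁻¹ |p|^{3/2}`-type bound before Hölder),
given the bounds on the weight: `|φₜ + νΔφ| ≤ c θ²`, `|∇φ| ≤ c θ⁻²`, `0 ≤ φ ≤ c θ⁻¹`. [folklore] -/
theorem abs_rhs_le_cubic {v g w : E} {π φv d c θ : ℝ} (hd : |d| ≤ c * θ ^ 2)
    (hg : ‖g‖ ≤ c * (θ ^ 2)⁻¹) (hφ0 : 0 ≤ φv) (hφ1 : φv ≤ c * θ⁻¹) :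
    |‖v‖ ^ 2 * d + (‖v‖ ^ 2 + 2 * π) * ⟪v, g⟫ + 2 * ⟪w, v⟫ * φv| ≤
      c * θ ^ 2 * ‖v‖ ^ 2 + c * (θ ^ 2)⁻¹ * (‖v‖ ^ 2 * ‖v‖) +
        2 * c * (θ ^ 2)⁻¹ * (|π| * ‖v‖) + 2 * c * θ⁻¹ * (‖w‖ * ‖v‖) := by
  have h := abs_rhs_le (v := v) (g := g) (w := w) (π := π) (a := 0) (φv := φv) hd hg hφ0 hφ1
  simp only [sub_zero] at h
  rw [abs_of_nonneg (sq_nonneg ‖v‖)] at h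
  exact h

omit [InnerProductSpace ℝ E] in
/-- The four-term bound in `ℝ≥0∞` form (crude cubic term). [folklore] -/
theorem ofReal_rhs_bound_eq_cubic {v w : E} {π c θ : ℝ} (hc : 0 ≤ c) (hθ : 0 ≤ θ) :
    ENNReal.ofReal (c * θ ^ 2 * ‖v‖ ^ 2 + c * (θ ^ 2)⁻¹ * (‖v‖ ^ 2 * ‖v‖) +
        2 * c * (θ ^ 2)⁻¹ * (|π| * ‖v‖) + 2 * c * θ⁻¹ * (‖w‖ * ‖v‖)) =
      ENNReal.ofReal (c * θ ^ 2) * ‖v‖ₑ ^ 2 +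
        ENNReal.ofReal (c * (θ ^ 2)⁻¹) * (‖v‖ₑ ^ 2 * ‖v‖ₑ) +
        ENNReal.ofReal (2 * c * (θ ^ 2)⁻¹) * (‖π‖ₑ * ‖v‖ₑ) +
        ENNReal.ofReal (2 * c * θ⁻¹) * (‖w‖ₑ * ‖v‖ₑ) := by
  have h := ofReal_rhs_bound_eq (v := v) (w := w) (π := π) (a := 0) hc hθ
  have e1 : |‖v‖ ^ 2 - 0| = ‖v‖ ^ 2 := by rw [sub_zero, abs_of_nonneg (sq_nonneg _)]
  have e2 : ‖‖v‖ ^ 2 - 0‖ₑ = ‖v‖ₑ ^ 2 := by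
    rw [sub_zero, Real.enorm_eq_ofReal (sq_nonneg _), ENNReal.ofReal_pow (norm_nonneg _),
      ofReal_norm]
  rw [e1, e2] at h
  exact h

end RHS

/-! ### Finiteness of `F_q(1)` from the `L^q` class of the force -/

/-- **`F_q(1) < ∞`** when `f ∈ L^q(Q)` and `Q₁(0) ⊆ Q` (`q > 0`). [folklore] -/
theorem cknF_one_ne_top_of_memLp {Q : Opens (ℝ × EuclideanSpace ℝ (Fin 3))} {q : ℝ} (hq : 0 < q)
    {f : ℝ → EuclideanSpace ℝ (Fin 3) → EuclideanSpace ℝ (Fin 3)}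
    (hf : MemLp (uncurry f) (ENNReal.ofReal q)
      (volume.restrict (Q : Set (ℝ × EuclideanSpace ℝ (Fin 3)))))
    (hsub : parabolicCylinder 1 (0 : ℝ × EuclideanSpace ℝ (Fin 3)) ⊆
      (Q : Set (ℝ × EuclideanSpace ℝ (Fin 3)))) :
    cknF q 1 0 f ≠ ∞ := by
  have h1 := hf.eLpNorm_lt_top
  rw [eLpNorm_lt_top_iff_lintegral_rpow_enorm_lt_top (ENNReal.ofReal_pos.2 hq).ne'
    ENNReal.ofReal_ne_top, ENNReal.toReal_ofReal hq.le] at h1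
  have h2 : ∫⁻ w in parabolicCylinder 1 (0 : ℝ × EuclideanSpace ℝ (Fin 3)), ‖f w.1 w.2‖ₑ ^ q ≤
      ∫⁻ w in (Q : Set (ℝ × EuclideanSpace ℝ (Fin 3))), ‖uncurry f w‖ₑ ^ q :=
    lintegral_mono_set hsub
  simp only [cknF, Real.one_rpow, ENNReal.ofReal_one, one_mul]
  exact (lt_of_le_of_lt h2 h1).ne

/-! ### The bound at unit scale, raw form -/

section UnitScale

set_option maxHeartbeats 1600000 in
-- the assembled measure-theoretic argument is long; the heartbeat bump only covers this proof
/-- **The absolute local-energy bound at unit scale, raw form** (Lemarié-Rieusset, proof of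
Thm. 14.4, scan p. 506, first display, in the tree's backward-cylinder vocabulary; cf.
Robinson–Rodrigo–Sadowski 2016, (16.6) without the mean subtraction): with Scheffer's constant
`c_T = c_T(ν)` and absolute `c₁, c₂`,
`A(θ) + E(θ) ≤ (1 + (2ν)⁻¹) c_T (c_T θ² c₁ C^{2/3} + c_T θ⁻² C + 2c_T θ⁻² D^{2/3} C^{1/3}
  + 2c_T c₂ θ⁻¹ F_q^{1/q} C^{1/3})`, all quantities at `r = 1`, `z = 0`, assumed finite; the force
exponent is any `q ≥ 3/2`. [cite: Lemarierieusset2023, §14.3 proof of Thm. 14.4, display before (14.19) (scan p. 506)] -/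
theorem localEnergyBound_master {ν : ℝ} (hν : 0 < ν) :
    ∃ cT c1 c2 : ℝ, 0 < cT ∧ 0 ≤ c1 ∧ 1 ≤ c2 ∧
      ∀ (Q : Opens (ℝ × EuclideanSpace ℝ (Fin 3))) (q : ℝ)
        (f u : ℝ → EuclideanSpace ℝ (Fin 3) → EuclideanSpace ℝ (Fin 3))
        (p : ℝ → EuclideanSpace ℝ (Fin 3) → ℝ)
        (G : ℝ → EuclideanSpace ℝ (Fin 3) → EuclideanSpace ℝ (Fin 3) →L[ℝ] EuclideanSpace ℝ (Fin 3)),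
        IsSuitableWeakSolutionOn Q ν f u p → 3 / 2 ≤ q →
        MemLp (uncurry f) (ENNReal.ofReal q)
          (volume.restrict (Q : Set (ℝ × EuclideanSpace ℝ (Fin 3)))) →
        HasWeakSpatialGradientOn Q u G →
        closure (parabolicCylinder 1 (0 : ℝ × EuclideanSpace ℝ (Fin 3))) ⊆
          (Q : Set (ℝ × EuclideanSpace ℝ (Fin 3))) →
        cknAEss 1 0 u ≠ ∞ → cknE 1 0 G ≠ ∞ → cknC 1 0 u ≠ ∞ → cknD 1 0 p ≠ ∞ → cknF q 1 0 f ≠ ∞ →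
        ∀ θ : ℝ, 0 < θ → θ ≤ 1 / 2 →
          cknAEss θ 0 u + cknE θ 0 G ≤ ENNReal.ofReal ((1 + (2 * ν)⁻¹) * cT) *
            (ENNReal.ofReal (cT * θ ^ 2 * c1) * cknC 1 0 u ^ (2 / 3 : ℝ) +
              ENNReal.ofReal (cT * (θ ^ 2)⁻¹) * cknC 1 0 u +
              ENNReal.ofReal (2 * cT * (θ ^ 2)⁻¹) * cknD 1 0 p ^ (2 / 3 : ℝ) * cknC 1 0 u ^ (1 / 3 : ℝ) +
              ENNReal.ofReal (2 * cT * c2 * θ⁻¹) * cknF q 1 0 f ^ (1 / q) *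
                cknC 1 0 u ^ (1 / 3 : ℝ)) := by
  obtain ⟨cT, hcT, hspec⟩ := Scheffer.testFn_spec (E := EuclideanSpace ℝ (Fin 3)) hν
  set S : Set (ℝ × EuclideanSpace ℝ (Fin 3)) := Ioo (-1 : ℝ) 0 ×ˢ ball (0 : EuclideanSpace ℝ (Fin 3)) 1
    with hS
  have hSmeas : MeasurableSet S := measurableSet_Ioo.prod measurableSet_ball
  have hSvol : volume S < ∞ := by
    have hsub : S ⊆ Icc (-1 : ℝ) 0 ×ˢ closedBall (0 : EuclideanSpace ℝ (Fin 3)) 1 :=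
      prod_mono Ioo_subset_Icc_self ball_subset_closedBall
    exact lt_of_le_of_lt (measure_mono hsub)
      ((isCompact_Icc.prod (isCompact_closedBall _ _)).measure_lt_top)
  set c1 : ℝ := ((volume S) ^ (1 / 3 : ℝ)).toReal with hc1
  set c2 : ℝ := (max 1 (volume S)).toReal with hc2
  have hc1eq : ENNReal.ofReal c1 = (volume S) ^ (1 / 3 : ℝ) :=
    ENNReal.ofReal_toReal (ENNReal.rpow_ne_top_of_nonneg (by norm_num) hSvol.ne)
  have hmaxne : max 1 (volume S) ≠ ∞ := by simp [hSvol.ne]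
  have hc2eq : ENNReal.ofReal c2 = max 1 (volume S) := ENNReal.ofReal_toReal hmaxne
  have hc2one : 1 ≤ c2 := by
    have : (1 : ℝ≥0∞).toReal ≤ (max 1 (volume S)).toReal := ENNReal.toReal_mono hmaxne (le_max_left _ _)
    simpa using this
  refine ⟨cT, c1, c2, hcT, ENNReal.toReal_nonneg, hc2one, ?_⟩
  intro Q q f u p G hsol hq hf hG hcl hA hE hC hD hF θ hθ hθ2
  have hθ1 : θ < 1 := by linarith
  have hν2 : 0 < 2 * ν := by positivity
  -- ### Step 1: restriction to `Q₁ = (-1, 0) × B₁`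
  have hcylS : parabolicCylinder 1 (0 : ℝ × EuclideanSpace ℝ (Fin 3)) = S := by
    simp [parabolicCylinder, hS]
  have hQS : ((parabolicCylinderOpens 1 (0 : ℝ × EuclideanSpace ℝ (Fin 3)) :
      Opens (ℝ × EuclideanSpace ℝ (Fin 3))) : Set (ℝ × EuclideanSpace ℝ (Fin 3))) = S := by
    rw [coe_parabolicCylinderOpens, hcylS]
  have hSQ : S ⊆ (Q : Set (ℝ × EuclideanSpace ℝ (Fin 3))) := by
    rw [← hcylS]; exact subset_closure.trans hcl
  have hle : parabolicCylinderOpens 1 (0 : ℝ × EuclideanSpace ℝ (Fin 3)) ≤ Q := by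
    intro z hz
    exact hSQ (hQS ▸ hz)
  have h₁ : IsSuitableWeakSolutionOn (parabolicCylinderOpens 1 (0 : ℝ × EuclideanSpace ℝ (Fin 3)))
      ν f u p := hsol.of_le hle
  have hG₁ : HasWeakSpatialGradientOn (parabolicCylinderOpens 1 (0 : ℝ × EuclideanSpace ℝ (Fin 3)))
      u G := hG.mono hle
  -- measurability on `S`
  have hum : AEStronglyMeasurable (uncurry u) (volume.restrict S) := by
    have := hG₁.locallyIntegrableOn.aestronglyMeasurable; rwa [hQS] at this
  have hGm : AEStronglyMeasurable (uncurry G) (volume.restrict S) := by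
    have := hG₁.locallyIntegrableOn_grad.aestronglyMeasurable; rwa [hQS] at this
  have hpm : AEStronglyMeasurable (uncurry p) (volume.restrict S) := by
    have := h₁.distributional.2.2.1.aestronglyMeasurable; rwa [hQS] at this
  have hfS : MemLp (uncurry f) (ENNReal.ofReal q) (volume.restrict S) :=
    hf.mono_measure (Measure.restrict_mono_set _ hSQ)
  have hfm : AEStronglyMeasurable (uncurry f) (volume.restrict S) := hfS.1
  -- the quantities at unit scale
  have hCeq : cknC 1 0 u = ∫⁻ z in S, ‖u z.1 z.2‖ₑ ^ (3 : ℕ) := by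
    simp only [cknC, ENNReal.ofReal_one, one_pow, inv_one, one_mul, hcylS]
  have hDeq : cknD 1 0 p = ∫⁻ z in S, ‖p z.1 z.2‖ₑ ^ (3 / 2 : ℝ) := by
    simp only [cknD, ENNReal.ofReal_one, one_pow, inv_one, one_mul, hcylS]
  have hEeq : cknE 1 0 G = ∫⁻ z in S, ENNReal.ofReal (frobeniusNormSq (G z.1 z.2)) := by
    simp only [cknE, ENNReal.ofReal_one, inv_one, one_mul, hcylS]
  have hFeq : cknF q 1 0 f = ∫⁻ z in S, ‖f z.1 z.2‖ₑ ^ q := by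
    simp only [cknF, Real.one_rpow, ENNReal.ofReal_one, one_mul, hcylS]
  have hfinS : IsFiniteMeasure (volume.restrict S) := ⟨by rw [Measure.restrict_apply_univ]; exact hSvol⟩
  have hu3S : ∫⁻ z in S, ‖u z.1 z.2‖ₑ ^ (3 : ℕ) < ∞ := by rw [← hCeq]; exact lt_top_iff_ne_top.2 hC
  -- ### Step 2: Scheffer's test function with inner radius `θ`
  set ψ : ℝ → EuclideanSpace ℝ (Fin 3) → ℝ := Scheffer.testFn ν θ 1 0 0 with hψdef
  obtain ⟨htest, hψ0, hψC, hψsupp, hψlow, hψgrad, hψheat⟩ :=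
    hspec 0 (0 : EuclideanSpace ℝ (Fin 3)) θ 1 hθ (by linarith)
  have hfin : Module.finrank ℝ (EuclideanSpace ℝ (Fin 3)) = 3 := finrank_euclideanSpace_fin
  have hheat : ∀ s (y : EuclideanSpace ℝ (Fin 3)), s < 0 →
      |timeDeriv ψ s y + ν * Δ (ψ s) y| ≤ cT * θ * θ ^ 2 := by
    intro s y hs
    have := hψheat s y (by nlinarith [sq_nonneg θ])
    rw [hfin, one_pow, div_one] at this
    calc _ ≤ cT * θ ^ 3 := this
      _ = cT * θ * θ ^ 2 := by ring
  have hgradb : ∀ s (y : EuclideanSpace ℝ (Fin 3)), ‖gradient (ψ s) y‖ ≤ cT * θ * (θ ^ 2)⁻¹ := by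
    intro s y
    have e : ‖gradient (ψ s) y‖ = ‖fderiv ℝ (ψ s) y‖ := by
      rw [gradient, LinearIsometryEquiv.norm_map]
    rw [e]
    calc ‖fderiv ℝ (ψ s) y‖ ≤ cT / θ := hψgrad s y
      _ = cT * θ * (θ ^ 2)⁻¹ := by field_simp
  have hψC' : ∀ s (y : EuclideanSpace ℝ (Fin 3)), ψ s y ≤ cT * θ * θ⁻¹ := fun s y =>
    (hψC s y).trans (le_of_eq (by field_simp))
  have hψsupp' : ∀ s (y : EuclideanSpace ℝ (Fin 3)), ψ s y ≠ 0 → |s| < 1 / 2 ∧ ‖y‖ < 5 / 8 := by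
    intro s y h
    have := hψsupp s y h
    simpa using this
  have hlow : ∀ s (y : EuclideanSpace ℝ (Fin 3)), -θ ^ 2 < s → s < θ ^ 2 → ‖y‖ < θ → cT⁻¹ ≤ ψ s y := by
    intro s y hs1 hs2 hy
    refine hψlow s y ?_
    rw [mem_parabolicCylinderCentered]
    refine ⟨⟨by simpa using hs1, by simpa using hs2⟩, by simpa using hy⟩
  -- continuity and support of the coefficient fields
  have hψ' : IsSpaceTimeTestOn (⊤ : Opens (ℝ × EuclideanSpace ℝ (Fin 3))) ψ := htest.mono le_top
  have hcψ : Continuous fun z : ℝ × EuclideanSpace ℝ (Fin 3) => ψ z.1 z.2 := htest.contDiff.continuous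
  have hcT' : Continuous fun z : ℝ × EuclideanSpace ℝ (Fin 3) => timeDeriv ψ z.1 z.2 :=
    hψ'.timeDeriv_top.contDiff.continuous
  have hcL : Continuous fun z : ℝ × EuclideanSpace ℝ (Fin 3) => Δ (ψ z.1) z.2 :=
    hψ'.laplacian_top.contDiff.continuous
  obtain ⟨hcg, -, hg0⟩ := htest.continuous_gradient_field
  set K : Set (ℝ × EuclideanSpace ℝ (Fin 3)) := tsupport (uncurry ψ) with hK
  have hg0' : ∀ z ∉ K, gradient (ψ z.1) z.2 = 0 := hg0
  have hψK : ∀ z ∉ K, ψ z.1 z.2 = 0 := fun z hz =>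
    show uncurry ψ z = 0 from image_eq_zero_of_notMem_tsupport hz
  have hTK : ∀ z ∉ K, timeDeriv ψ z.1 z.2 = 0 := fun z hz =>
    IsSpaceTimeTestOn.timeDeriv_eq_zero_of_notMem hz
  have hLK : ∀ z ∉ K, Δ (ψ z.1) z.2 = 0 := fun z hz =>
    laplacian_eq_zero_of_notMem_tsupport (notMem_tsupport_slice hz)
  have hKS : ∀ z ∈ K, z.1 < 0 → z ∈ S := by
    intro z hz hz0
    have hK' : K ⊆ Icc (-(1 / 2 : ℝ)) (1 / 2) ×ˢ closedBall (0 : EuclideanSpace ℝ (Fin 3)) (5 / 8) := by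
      refine closure_minimal (fun w hw => ?_) (isClosed_Icc.prod isClosed_closedBall)
      have h := hψsupp' w.1 w.2 hw
      refine ⟨⟨by linarith [(abs_lt.1 h.1).1], by linarith [(abs_lt.1 h.1).2]⟩, ?_⟩
      rw [mem_closedBall, dist_zero_right]; exact h.2.le
    obtain ⟨⟨hw1, -⟩, hw2⟩ := hK' hz
    rw [mem_closedBall, dist_zero_right] at hw2
    refine ⟨⟨by linarith, hz0⟩, ?_⟩
    rw [mem_ball, dist_zero_right]; linarith
  have hnotK : ∀ z : ℝ × EuclideanSpace ℝ (Fin 3), z.1 < 0 → z ∉ S → z ∉ K :=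
    fun z hz0 hzS hzK => hzS (hKS z hzK hz0)
  -- ### Step 3: the sliced local energy inequality
  have hfuS : IntegrableOn (fun z : ℝ × EuclideanSpace ℝ (Fin 3) => ⟪f z.1 z.2, u z.1 z.2⟫) S volume :=
    integrable_inner_of_memLp_of_lintegral_cube (volume.restrict S) hq hfS hum hu3S
  have hu3I : IntegrableOn (fun z : ℝ × EuclideanSpace ℝ (Fin 3) => ‖u z.1 z.2‖ ^ 3) S volume := by
    refine ⟨hum.norm.pow 3, ?_⟩
    rw [hasFiniteIntegral_iff_enorm]
    refine lt_of_le_of_lt (lintegral_mono fun z => ?_) hu3S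
    rw [Real.enorm_eq_ofReal (by positivity), ENNReal.ofReal_pow (norm_nonneg _), ofReal_norm]
  have hLEI := ae_localEnergy_slice_cutoff h₁ hG₁ (by rw [hcylS]; exact hu3I.locallyIntegrableOn)
    (by rw [hcylS]; exact hfuS.locallyIntegrableOn) htest.contDiff hψ0
    (fun s y h => by linarith [(abs_lt.1 (hψsupp' s y h).1).1]) (fun s y h => (hψsupp' s y h).2)
  -- ### Step 4: slice facts
  obtain ⟨hslice, -, -⟩ := ae_slice_sq_facts hG₁ hA
  set A := cknAEss 1 0 u with hAdef
  -- ### Step 5: the dominating function on `S` and its integral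
  set bound : ℝ × EuclideanSpace ℝ (Fin 3) → ℝ := fun z =>
    cT * θ * θ ^ 2 * ‖u z.1 z.2‖ ^ 2 +
      cT * θ * (θ ^ 2)⁻¹ * (‖u z.1 z.2‖ ^ 2 * ‖u z.1 z.2‖) +
      2 * (cT * θ) * (θ ^ 2)⁻¹ * (|p z.1 z.2| * ‖u z.1 z.2‖) +
      2 * (cT * θ) * θ⁻¹ * (‖f z.1 z.2‖ * ‖u z.1 z.2‖) with hbound
  have hbound0 : ∀ z, 0 ≤ bound z := fun z => by
    simp only [hbound]
    have := hcT.le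
    positivity
  set L : ℝ≥0∞ := ∫⁻ z in S, ENNReal.ofReal (bound z) with hL
  -- the four integrals
  set I1 : ℝ≥0∞ := ∫⁻ z in S, ‖u z.1 z.2‖ₑ ^ 2 with hI1
  set I2 : ℝ≥0∞ := ∫⁻ z in S, ‖u z.1 z.2‖ₑ ^ 2 * ‖u z.1 z.2‖ₑ with hI2
  set I3 : ℝ≥0∞ := ∫⁻ z in S, ‖p z.1 z.2‖ₑ * ‖u z.1 z.2‖ₑ with hI3
  set I4 : ℝ≥0∞ := ∫⁻ z in S, ‖f z.1 z.2‖ₑ * ‖u z.1 z.2‖ₑ with hI4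
  have hI1m : AEMeasurable (fun z : ℝ × EuclideanSpace ℝ (Fin 3) => ‖u z.1 z.2‖ₑ ^ 2)
      (volume.restrict S) := hum.enorm.pow_const 2
  have hI2m : AEMeasurable (fun z : ℝ × EuclideanSpace ℝ (Fin 3) =>
      ‖u z.1 z.2‖ₑ ^ 2 * ‖u z.1 z.2‖ₑ) (volume.restrict S) := hI1m.mul hum.enorm
  have hI3m : AEMeasurable (fun z : ℝ × EuclideanSpace ℝ (Fin 3) => ‖p z.1 z.2‖ₑ * ‖u z.1 z.2‖ₑ)
      (volume.restrict S) := hpm.enorm.mul hum.enorm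
  have hI4m : AEMeasurable (fun z : ℝ × EuclideanSpace ℝ (Fin 3) => ‖f z.1 z.2‖ₑ * ‖u z.1 z.2‖ₑ)
      (volume.restrict S) := hfm.enorm.mul hum.enorm
  have hLeq : L = ENNReal.ofReal (cT * θ * θ ^ 2) * I1 + ENNReal.ofReal (cT * θ * (θ ^ 2)⁻¹) * I2 +
      ENNReal.ofReal (2 * (cT * θ) * (θ ^ 2)⁻¹) * I3 + ENNReal.ofReal (2 * (cT * θ) * θ⁻¹) * I4 := by
    have hc : 0 ≤ cT * θ := by positivity
    have m1 : AEMeasurable (fun z : ℝ × EuclideanSpace ℝ (Fin 3) =>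
        ENNReal.ofReal (cT * θ * θ ^ 2) * ‖u z.1 z.2‖ₑ ^ 2) (volume.restrict S) := hI1m.const_mul _
    have m2 : AEMeasurable (fun z : ℝ × EuclideanSpace ℝ (Fin 3) =>
        ENNReal.ofReal (cT * θ * (θ ^ 2)⁻¹) * (‖u z.1 z.2‖ₑ ^ 2 * ‖u z.1 z.2‖ₑ))
        (volume.restrict S) := hI2m.const_mul _
    have m3 : AEMeasurable (fun z : ℝ × EuclideanSpace ℝ (Fin 3) =>
        ENNReal.ofReal (2 * (cT * θ) * (θ ^ 2)⁻¹) * (‖p z.1 z.2‖ₑ * ‖u z.1 z.2‖ₑ))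
        (volume.restrict S) := hI3m.const_mul _
    calc L = ∫⁻ z in S, (ENNReal.ofReal (cT * θ * θ ^ 2) * ‖u z.1 z.2‖ₑ ^ 2 +
          ENNReal.ofReal (cT * θ * (θ ^ 2)⁻¹) * (‖u z.1 z.2‖ₑ ^ 2 * ‖u z.1 z.2‖ₑ) +
          ENNReal.ofReal (2 * (cT * θ) * (θ ^ 2)⁻¹) * (‖p z.1 z.2‖ₑ * ‖u z.1 z.2‖ₑ) +
          ENNReal.ofReal (2 * (cT * θ) * θ⁻¹) * (‖f z.1 z.2‖ₑ * ‖u z.1 z.2‖ₑ)) :=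
          lintegral_congr fun z => ofReal_rhs_bound_eq_cubic hc hθ.le
      _ = (∫⁻ z in S, ENNReal.ofReal (cT * θ * θ ^ 2) * ‖u z.1 z.2‖ₑ ^ 2) +
          (∫⁻ z in S, ENNReal.ofReal (cT * θ * (θ ^ 2)⁻¹) * (‖u z.1 z.2‖ₑ ^ 2 * ‖u z.1 z.2‖ₑ)) +
          (∫⁻ z in S, ENNReal.ofReal (2 * (cT * θ) * (θ ^ 2)⁻¹) * (‖p z.1 z.2‖ₑ * ‖u z.1 z.2‖ₑ)) +
          (∫⁻ z in S, ENNReal.ofReal (2 * (cT * θ) * θ⁻¹) * (‖f z.1 z.2‖ₑ * ‖u z.1 z.2‖ₑ)) := by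
          have m12 : AEMeasurable (fun z : ℝ × EuclideanSpace ℝ (Fin 3) =>
              ENNReal.ofReal (cT * θ * θ ^ 2) * ‖u z.1 z.2‖ₑ ^ 2 +
              ENNReal.ofReal (cT * θ * (θ ^ 2)⁻¹) * (‖u z.1 z.2‖ₑ ^ 2 * ‖u z.1 z.2‖ₑ))
              (volume.restrict S) := m1.add m2
          have m123 : AEMeasurable (fun z : ℝ × EuclideanSpace ℝ (Fin 3) =>
              ENNReal.ofReal (cT * θ * θ ^ 2) * ‖u z.1 z.2‖ₑ ^ 2 +
              ENNReal.ofReal (cT * θ * (θ ^ 2)⁻¹) * (‖u z.1 z.2‖ₑ ^ 2 * ‖u z.1 z.2‖ₑ) +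
              ENNReal.ofReal (2 * (cT * θ) * (θ ^ 2)⁻¹) * (‖p z.1 z.2‖ₑ * ‖u z.1 z.2‖ₑ))
              (volume.restrict S) := m12.add m3
          rw [lintegral_add_left' m123, lintegral_add_left' m12, lintegral_add_left' m1]
      _ = _ := by
          rw [hI1, hI2, hI3, hI4, lintegral_const_mul' _ _ ENNReal.ofReal_ne_top,
            lintegral_const_mul' _ _ ENNReal.ofReal_ne_top, lintegral_const_mul' _ _ ENNReal.ofReal_ne_top,
            lintegral_const_mul' _ _ ENNReal.ofReal_ne_top]
  -- the four bounds
  have hB1 : I1 ≤ cknC 1 0 u ^ (2 / 3 : ℝ) * ENNReal.ofReal c1 := by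
    rw [hc1eq, hCeq, hI1]
    have := lintegral_sq_le_cube (volume.restrict S) hum.enorm
    rwa [Measure.restrict_apply_univ] at this
  have hB2 : I2 = cknC 1 0 u := by
    rw [hCeq, hI2]
    refine lintegral_congr fun z => ?_
    ring
  have hB3 : I3 ≤ cknD 1 0 p ^ (2 / 3 : ℝ) * cknC 1 0 u ^ (1 / 3 : ℝ) := by
    rw [hDeq, hCeq, hI3]
    exact lintegral_mul_le_threeHalves_three (volume.restrict S) hpm.enorm hum.enorm
  have hB4 : I4 ≤ ENNReal.ofReal c2 * cknF q 1 0 f ^ (1 / q) * cknC 1 0 u ^ (1 / 3 : ℝ) := by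
    have hq1 : 1 < q := by linarith
    set q' : ℝ := q.conjExponent with hq'
    have hqq' : q.HolderConjugate q' := Real.HolderConjugate.conjExponent hq1
    have hq'0 : 0 < q' := hqq'.symm.pos
    have hq'3 : q' ≤ 3 := by
      have e1 : q' = q / (q - 1) := rfl
      rw [e1, div_le_iff₀ (by linarith)]
      linarith
    have hH := ENNReal.lintegral_mul_le_Lp_mul_Lq (volume.restrict S) hqq' hfm.enorm hum.enorm
    simp only [Pi.mul_apply] at hH
    -- `(∫ |u|^{q'})^{1/q'} = ‖u‖_{L^{q'}(S)} ≤ ‖u‖_{L³(S)} |S|^{1/q' - 1/3}`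
    have hq'e : (ENNReal.ofReal q').toReal = q' := ENNReal.toReal_ofReal hq'0.le
    have e1 : (∫⁻ z in S, ‖uncurry u z‖ₑ ^ q') ^ (1 / q') =
        eLpNorm (uncurry u) (ENNReal.ofReal q') (volume.restrict S) := by
      rw [eLpNorm_eq_lintegral_rpow_enorm_toReal (by simp [hq'0]) ENNReal.ofReal_ne_top, hq'e]
    have e3 : eLpNorm (uncurry u) 3 (volume.restrict S) = cknC 1 0 u ^ (1 / 3 : ℝ) := by
      rw [eLpNorm_eq_lintegral_rpow_enorm_toReal (by norm_num) (by norm_num), hCeq]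
      simp only [ENNReal.toReal_ofNat, one_div]
      congr 1
      refine lintegral_congr fun z => ?_
      rw [show (3 : ℝ) = ((3 : ℕ) : ℝ) by norm_num, ENNReal.rpow_natCast]
      rfl
    have hcmp : eLpNorm (uncurry u) (ENNReal.ofReal q') (volume.restrict S) ≤
        eLpNorm (uncurry u) 3 (volume.restrict S) * (volume.restrict S) univ ^
          (1 / (ENNReal.ofReal q').toReal - 1 / (3 : ℝ≥0∞).toReal) :=
      eLpNorm_le_eLpNorm_mul_rpow_measure_univ
        (ENNReal.ofReal_le_of_le_toReal (by simpa using hq'3)) hum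
    rw [hq'e, ENNReal.toReal_ofNat, Measure.restrict_apply_univ, e3] at hcmp
    have hexp0 : 0 ≤ 1 / q' - 1 / 3 := by
      rw [sub_nonneg]; exact one_div_le_one_div_of_le hq'0 hq'3
    have hexp1 : 1 / q' - 1 / 3 ≤ 1 := by
      have : 0 < 1 / q' := by positivity
      have : 1 / q' ≤ 1 := by rw [div_le_one hq'0]; exact hqq'.symm.lt.le
      linarith
    have hvolb : volume S ^ (1 / q' - 1 / 3) ≤ ENNReal.ofReal c2 := by
      rw [hc2eq]; exact ENNReal.rpow_le_max_one_self hexp0 hexp1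
    have hFq : (∫⁻ z in S, ‖uncurry f z‖ₑ ^ q) ^ (1 / q) = cknF q 1 0 f ^ (1 / q) := by
      rw [hFeq]; rfl
    calc I4 = ∫⁻ z in S, ‖uncurry f z‖ₑ * ‖uncurry u z‖ₑ := rfl
      _ ≤ (∫⁻ z in S, ‖uncurry f z‖ₑ ^ q) ^ (1 / q) * (∫⁻ z in S, ‖uncurry u z‖ₑ ^ q') ^ (1 / q') := hH
      _ ≤ cknF q 1 0 f ^ (1 / q) * (cknC 1 0 u ^ (1 / 3 : ℝ) * ENNReal.ofReal c2) := by
          rw [hFq, e1]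
          gcongr
          exact hcmp.trans (by gcongr)
      _ = _ := by ring
  have hLtop : L ≠ ∞ := by
    rw [hLeq]
    have hCt : cknC 1 0 u ^ (1 / 3 : ℝ) ≠ ∞ := ENNReal.rpow_ne_top_of_nonneg (by norm_num) hC
    refine ENNReal.add_ne_top.2 ⟨ENNReal.add_ne_top.2 ⟨ENNReal.add_ne_top.2 ⟨?_, ?_⟩, ?_⟩, ?_⟩
    · refine ENNReal.mul_ne_top ENNReal.ofReal_ne_top (ne_top_of_le_ne_top ?_ hB1)
      exact ENNReal.mul_ne_top (ENNReal.rpow_ne_top_of_nonneg (by norm_num) hC) ENNReal.ofReal_ne_top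
    · rw [hB2]
      exact ENNReal.mul_ne_top ENNReal.ofReal_ne_top hC
    · refine ENNReal.mul_ne_top ENNReal.ofReal_ne_top (ne_top_of_le_ne_top ?_ hB3)
      exact ENNReal.mul_ne_top (ENNReal.rpow_ne_top_of_nonneg (by norm_num) hD) hCt
    · refine ENNReal.mul_ne_top ENNReal.ofReal_ne_top (ne_top_of_le_ne_top ?_ hB4)
      exact ENNReal.mul_ne_top (ENNReal.mul_ne_top ENNReal.ofReal_ne_top
        (ENNReal.rpow_ne_top_of_nonneg (by positivity) hF)) hCt
  -- ### Step 6: the right-hand side of the sliced inequality is at most `L.toReal`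
  set d : ℝ × EuclideanSpace ℝ (Fin 3) → ℝ := fun z => timeDeriv ψ z.1 z.2 + ν * Δ (ψ z.1) z.2 with hd
  set g : ℝ × EuclideanSpace ℝ (Fin 3) → EuclideanSpace ℝ (Fin 3) := fun z => gradient (ψ z.1) z.2
    with hg
  set R' : ℝ × EuclideanSpace ℝ (Fin 3) → ℝ := fun z =>
    ‖u z.1 z.2‖ ^ 2 * d z + (‖u z.1 z.2‖ ^ 2 + 2 * p z.1 z.2) * ⟪u z.1 z.2, g z⟫ +
      2 * ⟪f z.1 z.2, u z.1 z.2⟫ * ψ z.1 z.2 with hR'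
  have hdc : Continuous d := hcT'.add (continuous_const.mul hcL)
  -- `|R'| ≤ bound` in negative time, `R' = 0` off `S` in negative time
  have hR'le : ∀ z : ℝ × EuclideanSpace ℝ (Fin 3), z.1 < 0 → ‖R' z‖ ≤ bound z := by
    intro z hz
    rw [Real.norm_eq_abs, hR', hbound]
    exact abs_rhs_le_cubic (hheat z.1 z.2 hz) (hgradb z.1 z.2) (hψ0 z.1 z.2) (hψC' z.1 z.2)
  have hR'zero : ∀ z : ℝ × EuclideanSpace ℝ (Fin 3), z.1 < 0 → z ∉ S → R' z = 0 := by
    intro z hz hzS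
    have hzK := hnotK z hz hzS
    simp only [hR', hd, hg, hTK z hzK, hLK z hzK, hg0' z hzK, hψK z hzK, inner_zero_right, mul_zero,
      add_zero]
  -- measurability and integrability on `S`
  have hu2m : AEStronglyMeasurable (fun z : ℝ × EuclideanSpace ℝ (Fin 3) => ‖u z.1 z.2‖ ^ 2)
      (volume.restrict S) := hum.norm.pow 2
  have hgm : AEStronglyMeasurable g (volume.restrict S) := hcg.aestronglyMeasurable
  have hψm : AEStronglyMeasurable (fun z : ℝ × EuclideanSpace ℝ (Fin 3) => ψ z.1 z.2)
      (volume.restrict S) := hcψ.aestronglyMeasurable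
  have hR'm : AEStronglyMeasurable R' (volume.restrict S) :=
    ((hu2m.mul hdc.aestronglyMeasurable).add
      ((hu2m.add (hpm.const_mul 2)).mul (hum.inner hgm))).add
      (((hfm.inner hum).const_mul 2).mul hψm)
  have hboundI : Integrable bound (volume.restrict S) := by
    refine ⟨(((hu2m.const_mul _).add ((hu2m.mul hum.norm).const_mul _)).add
      ((hpm.norm.mul hum.norm).const_mul _)).add ((hfm.norm.mul hum.norm).const_mul _), ?_⟩
    rw [hasFiniteIntegral_iff_enorm]
    calc ∫⁻ z in S, ‖bound z‖ₑ = L := lintegral_congr fun z => Real.enorm_eq_ofReal (hbound0 z)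
      _ < ∞ := lt_top_iff_ne_top.2 hLtop
  have hR'I : IntegrableOn R' S volume :=
    hboundI.mono' hR'm ((ae_restrict_mem hSmeas).mono fun z hz => hR'le z hz.1.2)
  have hTs : ∀ s : ℝ, MeasurableSet {z : ℝ × EuclideanSpace ℝ (Fin 3) | z.1 < s} := fun s =>
    measurableSet_lt measurable_fst measurable_const
  have hR'Is : ∀ s, s < 0 → IntegrableOn R' {z | z.1 < s} volume := fun s hs =>
    hR'I.of_forall_sdiff_eq_zero (hTs s) fun z hz => hR'zero z (lt_trans hz.1 hs) hz.2
  -- consequences of the sliced inequality at good times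
  have hgood : ∀ᵐ s ∂(volume : Measure ℝ), s < 0 →
      (∫ x, ‖u s x‖ ^ 2 * ψ s x) ≤ L.toReal ∧
      2 * ν * ∫ z in {z : ℝ × EuclideanSpace ℝ (Fin 3) | z.1 < s},
        frobeniusNormSq (G z.1 z.2) * ψ z.1 z.2 ≤ L.toReal := by
    filter_upwards [hLEI] with s hs hs0
    have key := hs hs0
    have hsplit : ∫ z in {z : ℝ × EuclideanSpace ℝ (Fin 3) | z.1 < s},
        (‖u z.1 z.2‖ ^ 2 * (timeDeriv ψ z.1 z.2 + ν * Δ (ψ z.1) z.2) +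
          (‖u z.1 z.2‖ ^ 2 + 2 * p z.1 z.2) * ⟪u z.1 z.2, gradient (ψ z.1) z.2⟫ +
          2 * ⟪f z.1 z.2, u z.1 z.2⟫ * ψ z.1 z.2) =
        ∫ z in {z : ℝ × EuclideanSpace ℝ (Fin 3) | z.1 < s}, R' z := by
      refine integral_congr_ae (ae_of_all _ fun z => ?_)
      simp only [hR', hd, hg]
    have hRle : ∫ z in {z : ℝ × EuclideanSpace ℝ (Fin 3) | z.1 < s}, R' z ≤ L.toReal := by
      have h1 : ∫⁻ z in {z : ℝ × EuclideanSpace ℝ (Fin 3) | z.1 < s}, ENNReal.ofReal ‖R' z‖ ≤ L := by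
        calc ∫⁻ z in {z : ℝ × EuclideanSpace ℝ (Fin 3) | z.1 < s}, ENNReal.ofReal ‖R' z‖
            ≤ ∫⁻ z in {z : ℝ × EuclideanSpace ℝ (Fin 3) | z.1 < s},
                S.indicator (fun z => ENNReal.ofReal (bound z)) z := by
              refine setLIntegral_mono' (hTs s) fun z hz => ?_
              have hz0 : z.1 < 0 := lt_trans hz hs0
              by_cases hzS : z ∈ S
              · rw [indicator_of_mem hzS]
                exact ENNReal.ofReal_le_ofReal (hR'le z hz0)
              · rw [indicator_of_notMem hzS, hR'zero z hz0 hzS, norm_zero, ENNReal.ofReal_zero]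
          _ ≤ ∫⁻ z, S.indicator (fun z => ENNReal.ofReal (bound z)) z := setLIntegral_le_lintegral _ _
          _ = L := by rw [lintegral_indicator hSmeas]
      calc ∫ z in {z : ℝ × EuclideanSpace ℝ (Fin 3) | z.1 < s}, R' z
          ≤ ‖∫ z in {z : ℝ × EuclideanSpace ℝ (Fin 3) | z.1 < s}, R' z‖ := by
            rw [Real.norm_eq_abs]; exact le_abs_self _
        _ ≤ (∫⁻ z in {z : ℝ × EuclideanSpace ℝ (Fin 3) | z.1 < s}, ENNReal.ofReal ‖R' z‖).toReal :=
            norm_integral_le_lintegral_norm _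
        _ ≤ L.toReal := ENNReal.toReal_mono hLtop h1
    have hU0 : 0 ≤ ∫ x, ‖u s x‖ ^ 2 * ψ s x :=
      integral_nonneg fun x => mul_nonneg (sq_nonneg _) (hψ0 _ _)
    have hV0 : 0 ≤ ∫ z in {z : ℝ × EuclideanSpace ℝ (Fin 3) | z.1 < s},
        frobeniusNormSq (G z.1 z.2) * ψ z.1 z.2 :=
      integral_nonneg fun z => mul_nonneg (frobeniusNormSq_nonneg _) (hψ0 _ _)
    rw [hsplit] at key
    have hV0' : 0 ≤ 2 * ν * ∫ z in {z : ℝ × EuclideanSpace ℝ (Fin 3) | z.1 < s},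
        frobeniusNormSq (G z.1 z.2) * ψ z.1 z.2 := mul_nonneg hν2.le hV0
    constructor <;> nlinarith [key, hRle, hU0, hV0']
  -- ### Step 7: lower bounds — `A(θ)` and `E(θ)`
  have h1le : ∀ s (y : EuclideanSpace ℝ (Fin 3)), -θ ^ 2 < s → s < θ ^ 2 → ‖y‖ < θ → 1 ≤ cT * ψ s y := by
    intro s y hs1 hs2 hy
    have := mul_le_mul_of_nonneg_left (hlow s y hs1 hs2 hy) hcT.le
    rwa [mul_inv_cancel₀ hcT.ne'] at this
  have hAθ : cknAEss θ 0 u ≤ (ENNReal.ofReal θ)⁻¹ * (ENNReal.ofReal cT * ENNReal.ofReal L.toReal) := by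
    have hIθ : Ioo ((0 : ℝ × EuclideanSpace ℝ (Fin 3)).1 - θ ^ 2) (0 : ℝ × EuclideanSpace ℝ (Fin 3)).1 =
        Ioo (-θ ^ 2) 0 := by simp
    simp only [cknAEss, hIθ, Prod.snd_zero]
    refine essSup_le_of_ae_le _ ((ae_restrict_iff' measurableSet_Ioo).2 ?_)
    filter_upwards [hgood, hslice] with t hgt hsl ht
    have ht0 : t < 0 := ht.2
    have htI : t ∈ Ioo (-1 : ℝ) 0 := ⟨by nlinarith [ht.1], ht.2⟩
    obtain ⟨-, hint, -, -⟩ := hsl htI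
    obtain ⟨hU, -⟩ := hgt ht0
    gcongr
    have hWint : Integrable (fun x => ‖u t x‖ ^ 2 * ψ t x) volume := by
      have hWB : IntegrableOn (fun x => ‖u t x‖ ^ 2 * ψ t x) (ball 0 1) volume :=
        Integrable.mul_bdd hint (hcψ.comp (Continuous.prodMk_right t)).aestronglyMeasurable
          (ae_of_all _ fun x => by
            rw [Real.norm_eq_abs, abs_of_nonneg (hψ0 t x)]; exact hψC t x)
      refine hWB.integrable_of_forall_notMem_eq_zero fun x hx => ?_
      have : ψ t x = 0 := by
        by_contra h
        exact hx (by rw [mem_ball, dist_zero_right]; linarith [(hψsupp' t x h).2])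
      simp [this]
    calc ∫⁻ x in ball 0 θ, ‖u t x‖ₑ ^ 2
        ≤ ∫⁻ x in ball 0 θ, ENNReal.ofReal cT * ENNReal.ofReal (‖u t x‖ ^ 2 * ψ t x) := by
          refine setLIntegral_mono' measurableSet_ball fun x hx => ?_
          rw [mem_ball, dist_zero_right] at hx
          have hlo := h1le t x ht.1 (by nlinarith [sq_nonneg θ]) hx
          rw [← ENNReal.ofReal_mul hcT.le, ← ofReal_norm, ← ENNReal.ofReal_pow (norm_nonneg _)]
          refine ENNReal.ofReal_le_ofReal ?_
          nlinarith [sq_nonneg ‖u t x‖]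
      _ ≤ ENNReal.ofReal cT * ∫⁻ x, ENNReal.ofReal (‖u t x‖ ^ 2 * ψ t x) := by
          rw [lintegral_const_mul' _ _ ENNReal.ofReal_ne_top]
          exact mul_le_mul' le_rfl (setLIntegral_le_lintegral _ _)
      _ = ENNReal.ofReal cT * ENNReal.ofReal (∫ x, ‖u t x‖ ^ 2 * ψ t x) := by
          rw [ofReal_integral_eq_lintegral_ofReal hWint
            (ae_of_all _ fun x => mul_nonneg (sq_nonneg _) (hψ0 t x))]
      _ ≤ ENNReal.ofReal cT * ENNReal.ofReal L.toReal := by gcongr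
  have hEθ : cknE θ 0 G ≤ (ENNReal.ofReal θ)⁻¹ *
      (ENNReal.ofReal cT * ENNReal.ofReal (L.toReal / (2 * ν))) := by
    have hQθ : parabolicCylinder θ (0 : ℝ × EuclideanSpace ℝ (Fin 3)) =
        Ioo (-θ ^ 2) 0 ×ˢ ball (0 : EuclideanSpace ℝ (Fin 3)) θ := by
      simp [parabolicCylinder]
    simp only [cknE]
    gcongr
    refine setLIntegral_le_of_ae_neg_time (fun z hz => ?_) ?_
    · rw [hQθ] at hz; exact hz.1.2
    filter_upwards [hgood] with s hgs hs0
    obtain ⟨-, hV⟩ := hgs hs0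
    have hFS : IntegrableOn (fun z : ℝ × EuclideanSpace ℝ (Fin 3) =>
        frobeniusNormSq (G z.1 z.2) * ψ z.1 z.2) S volume := by
      have hfr : IntegrableOn (fun z : ℝ × EuclideanSpace ℝ (Fin 3) => frobeniusNormSq (G z.1 z.2)) S
          volume := by
        refine ⟨continuous_frobeniusNormSq'.comp_aestronglyMeasurable hGm, ?_⟩
        rw [hasFiniteIntegral_iff_enorm]
        calc ∫⁻ z in S, ‖frobeniusNormSq (G z.1 z.2)‖ₑ = cknE 1 0 G := by
              rw [hEeq]; exact lintegral_congr fun z => Real.enorm_eq_ofReal (frobeniusNormSq_nonneg _)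
          _ < ∞ := lt_top_iff_ne_top.2 hE
      exact hfr.mul_bdd hψm (ae_of_all _ fun z => by
        rw [Real.norm_eq_abs, abs_of_nonneg (hψ0 _ _)]; exact hψC _ _)
    have hFs : IntegrableOn (fun z : ℝ × EuclideanSpace ℝ (Fin 3) =>
        frobeniusNormSq (G z.1 z.2) * ψ z.1 z.2) {z : ℝ × EuclideanSpace ℝ (Fin 3) | z.1 < s} volume :=
      hFS.of_forall_sdiff_eq_zero (hTs s) fun z hz => by
        rw [hψK z (hnotK z (lt_trans hz.1 hs0) hz.2), mul_zero]
    calc ∫⁻ z in parabolicCylinder θ 0 ∩ {z : ℝ × EuclideanSpace ℝ (Fin 3) | z.1 < s},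
          ENNReal.ofReal (frobeniusNormSq (G z.1 z.2))
        ≤ ∫⁻ z in parabolicCylinder θ 0 ∩ {z : ℝ × EuclideanSpace ℝ (Fin 3) | z.1 < s},
            ENNReal.ofReal cT * ENNReal.ofReal (frobeniusNormSq (G z.1 z.2) * ψ z.1 z.2) := by
          refine setLIntegral_mono' ((isOpen_parabolicCylinder θ 0).measurableSet.inter (hTs s))
            fun z hz => ?_
          have hz1 := hz.1
          rw [hQθ] at hz1
          obtain ⟨⟨hz11, hz12⟩, hz2⟩ := hz1
          rw [mem_ball, dist_zero_right] at hz2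
          have hlo := h1le z.1 z.2 hz11 (by nlinarith [sq_nonneg θ]) hz2
          rw [← ENNReal.ofReal_mul hcT.le]
          refine ENNReal.ofReal_le_ofReal ?_
          nlinarith [frobeniusNormSq_nonneg (G z.1 z.2)]
      _ ≤ ENNReal.ofReal cT * ∫⁻ z in {z : ℝ × EuclideanSpace ℝ (Fin 3) | z.1 < s},
            ENNReal.ofReal (frobeniusNormSq (G z.1 z.2) * ψ z.1 z.2) := by
          rw [lintegral_const_mul' _ _ ENNReal.ofReal_ne_top]
          exact mul_le_mul' le_rfl (lintegral_mono_set inter_subset_right)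
      _ = ENNReal.ofReal cT * ENNReal.ofReal (∫ z in {z : ℝ × EuclideanSpace ℝ (Fin 3) | z.1 < s},
            frobeniusNormSq (G z.1 z.2) * ψ z.1 z.2) := by
          rw [ofReal_integral_eq_lintegral_ofReal hFs
            (ae_of_all _ fun z => mul_nonneg (frobeniusNormSq_nonneg _) (hψ0 _ _))]
      _ ≤ ENNReal.ofReal cT * ENNReal.ofReal (L.toReal / (2 * ν)) := by
          gcongr
          rw [le_div_iff₀ hν2]
          linarith
  -- ### Step 8: conclusion
  have hLr : ENNReal.ofReal L.toReal ≤ L := ENNReal.ofReal_toReal_le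
  have hLr2 : ENNReal.ofReal (L.toReal / (2 * ν)) ≤ ENNReal.ofReal ((2 * ν)⁻¹) * L := by
    rw [div_eq_mul_inv, mul_comm, ENNReal.ofReal_mul (inv_nonneg.2 hν2.le)]
    exact mul_le_mul' le_rfl hLr
  have hθinv : (ENNReal.ofReal θ)⁻¹ = ENNReal.ofReal θ⁻¹ := (ENNReal.ofReal_inv_of_pos hθ).symm
  have hfinal : ENNReal.ofReal θ⁻¹ * L ≤
      ENNReal.ofReal (cT * θ ^ 2 * c1) * cknC 1 0 u ^ (2 / 3 : ℝ) +
        ENNReal.ofReal (cT * (θ ^ 2)⁻¹) * cknC 1 0 u +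
        ENNReal.ofReal (2 * cT * (θ ^ 2)⁻¹) * cknD 1 0 p ^ (2 / 3 : ℝ) * cknC 1 0 u ^ (1 / 3 : ℝ) +
        ENNReal.ofReal (2 * cT * c2 * θ⁻¹) * cknF q 1 0 f ^ (1 / q) * cknC 1 0 u ^ (1 / 3 : ℝ) := by
    rw [hLeq, mul_add, mul_add, mul_add]
    have hθi : 0 ≤ θ⁻¹ := inv_nonneg.2 hθ.le
    refine add_le_add (add_le_add (add_le_add ?_ ?_) ?_) ?_
    · calc ENNReal.ofReal θ⁻¹ * (ENNReal.ofReal (cT * θ * θ ^ 2) * I1)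
          = ENNReal.ofReal (cT * θ ^ 2) * I1 := by
            rw [← mul_assoc, ← ENNReal.ofReal_mul hθi,
              show θ⁻¹ * (cT * θ * θ ^ 2) = cT * θ ^ 2 by field_simp]
        _ ≤ ENNReal.ofReal (cT * θ ^ 2) * (cknC 1 0 u ^ (2 / 3 : ℝ) * ENNReal.ofReal c1) := by gcongr
        _ = _ := by rw [ENNReal.ofReal_mul (by positivity : 0 ≤ cT * θ ^ 2)]; ring
    · calc ENNReal.ofReal θ⁻¹ * (ENNReal.ofReal (cT * θ * (θ ^ 2)⁻¹) * I2)
          = ENNReal.ofReal (cT * (θ ^ 2)⁻¹) * I2 := by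
            rw [← mul_assoc, ← ENNReal.ofReal_mul hθi,
              show θ⁻¹ * (cT * θ * (θ ^ 2)⁻¹) = cT * (θ ^ 2)⁻¹ by field_simp]
        _ = _ := by rw [hB2]
        _ ≤ _ := le_rfl
    · calc ENNReal.ofReal θ⁻¹ * (ENNReal.ofReal (2 * (cT * θ) * (θ ^ 2)⁻¹) * I3)
          = ENNReal.ofReal (2 * cT * (θ ^ 2)⁻¹) * I3 := by
            rw [← mul_assoc, ← ENNReal.ofReal_mul hθi,
              show θ⁻¹ * (2 * (cT * θ) * (θ ^ 2)⁻¹) = 2 * cT * (θ ^ 2)⁻¹ by field_simp]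
        _ ≤ ENNReal.ofReal (2 * cT * (θ ^ 2)⁻¹) * (cknD 1 0 p ^ (2 / 3 : ℝ) * cknC 1 0 u ^ (1 / 3 : ℝ)) := by
            gcongr
        _ = _ := by ring
    · calc ENNReal.ofReal θ⁻¹ * (ENNReal.ofReal (2 * (cT * θ) * θ⁻¹) * I4)
          = ENNReal.ofReal (2 * cT * θ⁻¹) * I4 := by
            rw [← mul_assoc, ← ENNReal.ofReal_mul hθi,
              show θ⁻¹ * (2 * (cT * θ) * θ⁻¹) = 2 * cT * θ⁻¹ by field_simp]
        _ ≤ ENNReal.ofReal (2 * cT * θ⁻¹) * (ENNReal.ofReal c2 * cknF q 1 0 f ^ (1 / q) *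
              cknC 1 0 u ^ (1 / 3 : ℝ)) := by gcongr
        _ = _ := by
            rw [show 2 * cT * c2 * θ⁻¹ = 2 * cT * θ⁻¹ * c2 by ring,
              ENNReal.ofReal_mul (by positivity : 0 ≤ 2 * cT * θ⁻¹)]
            ring
  have hν1 : 0 ≤ (2 * ν)⁻¹ := inv_nonneg.2 hν2.le
  calc cknAEss θ 0 u + cknE θ 0 G
      ≤ (ENNReal.ofReal θ)⁻¹ * (ENNReal.ofReal cT * ENNReal.ofReal L.toReal) +
          (ENNReal.ofReal θ)⁻¹ * (ENNReal.ofReal cT * ENNReal.ofReal (L.toReal / (2 * ν))) :=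
        add_le_add hAθ hEθ
    _ ≤ (ENNReal.ofReal θ)⁻¹ * (ENNReal.ofReal cT * L) +
          (ENNReal.ofReal θ)⁻¹ * (ENNReal.ofReal cT * (ENNReal.ofReal ((2 * ν)⁻¹) * L)) := by
        gcongr
    _ = ENNReal.ofReal ((1 + (2 * ν)⁻¹) * cT) * (ENNReal.ofReal θ⁻¹ * L) := by
        rw [hθinv, ENNReal.ofReal_mul (by positivity : (0 : ℝ) ≤ 1 + (2 * ν)⁻¹),
          ENNReal.ofReal_add zero_le_one hν1, ENNReal.ofReal_one]
        ring
    _ ≤ _ := by gcongr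

/-- **The absolute local-energy bound at unit scale** (finiteness derived): for `ν > 0` there
are `c₁, …, c₄` (depending only on `ν`) such that for every suitable weak solution with force
`f ∈ L^q(Q)`, `q ≥ 3/2`, every weak spatial gradient `G`, `closure Q₁(0) ⊆ Q` and
`0 < θ ≤ 1/2`,
`A(θ) + E(θ) ≤ c₁ θ² C(1)^{2/3} + c₂ θ⁻² C(1) + c₃ θ⁻² D(1)^{2/3} C(1)^{1/3} + c₄ θ⁻¹ F_q(1)^{1/q} C(1)^{1/3}`
(`A(1), E(1), D(1) < ∞` by the local classes, `C(1) < ∞` by the interpolation inequality,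
`F_q(1) < ∞` by `f ∈ L^q`). [cite: Lemarierieusset2023, §14.3 proof of Thm. 14.4, display before (14.19) (scan p. 506)] -/
theorem localEnergyBound_unitScale {ν : ℝ} (hν : 0 < ν) :
    ∃ c₁ c₂ c₃ c₄ : ℝ≥0, ∀ (Q : Opens (ℝ × EuclideanSpace ℝ (Fin 3))) (q : ℝ)
      (f u : ℝ → EuclideanSpace ℝ (Fin 3) → EuclideanSpace ℝ (Fin 3))
      (p : ℝ → EuclideanSpace ℝ (Fin 3) → ℝ)
      (G : ℝ → EuclideanSpace ℝ (Fin 3) → EuclideanSpace ℝ (Fin 3) →L[ℝ] EuclideanSpace ℝ (Fin 3)),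
      IsSuitableWeakSolutionOn Q ν f u p → 3 / 2 ≤ q →
      MemLp (uncurry f) (ENNReal.ofReal q)
        (volume.restrict (Q : Set (ℝ × EuclideanSpace ℝ (Fin 3)))) →
      HasWeakSpatialGradientOn Q u G →
      closure (parabolicCylinder 1 (0 : ℝ × EuclideanSpace ℝ (Fin 3))) ⊆
        (Q : Set (ℝ × EuclideanSpace ℝ (Fin 3))) →
      ∀ θ : ℝ, 0 < θ → θ ≤ 1 / 2 →
        cknAEss θ 0 u + cknE θ 0 G ≤
          c₁ * ENNReal.ofReal (θ ^ 2) * cknC 1 0 u ^ (2 / 3 : ℝ) +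
          c₂ * ENNReal.ofReal ((θ ^ 2)⁻¹) * cknC 1 0 u +
          c₃ * ENNReal.ofReal ((θ ^ 2)⁻¹) * cknD 1 0 p ^ (2 / 3 : ℝ) * cknC 1 0 u ^ (1 / 3 : ℝ) +
          c₄ * ENNReal.ofReal θ⁻¹ * cknF q 1 0 f ^ (1 / q) * cknC 1 0 u ^ (1 / 3 : ℝ) := by
  obtain ⟨cT, c1, c2, hcT, hc1, hc2, hM⟩ := localEnergyBound_master hν
  obtain ⟨C0, hC0⟩ := exists_cknC_le_rpow
  set cν : ℝ := (1 + (2 * ν)⁻¹) * cT with hcν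
  have hν2 : 0 < 2 * ν := by positivity
  have hcν0 : 0 ≤ cν := by positivity
  refine ⟨Real.toNNReal (cν * (cT * c1)), Real.toNNReal (cν * cT), Real.toNNReal (cν * (2 * cT)),
    Real.toNNReal (cν * (2 * cT * c2)), fun Q q f u p G hsol hq hf hG hcl θ hθ hθ2 => ?_⟩
  have hq0 : 0 < q := by linarith
  -- finiteness
  have hle : parabolicCylinderOpens 1 (0 : ℝ × EuclideanSpace ℝ (Fin 3)) ≤ Q := by
    intro z hz
    have hz' : z ∈ parabolicCylinder 1 (0 : ℝ × EuclideanSpace ℝ (Fin 3)) := by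
      rwa [← coe_parabolicCylinderOpens]
    exact hcl (subset_closure hz')
  have hA := hsol.cknAEss_one_ne_top hcl
  have hE := hsol.cknE_one_ne_top hG hcl
  have hD := hsol.cknD_one_ne_top hcl
  have hF : cknF q 1 0 f ≠ ∞ := cknF_one_ne_top_of_memLp hq0 hf (subset_closure.trans hcl)
  have hCle : cknC 1 0 u ≤ C0 * (cknAEss 1 0 u + cknE 1 0 G) ^ (3 / 2 : ℝ) :=
    hC0 u G 0 1 one_pos (hG.mono hle) hA hE
  have hC : cknC 1 0 u ≠ ∞ :=
    ne_top_of_le_ne_top (ENNReal.mul_ne_top ENNReal.coe_ne_top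
      (ENNReal.rpow_ne_top_of_nonneg (by norm_num) (ENNReal.add_ne_top.2 ⟨hA, hE⟩))) hCle
  have key := hM Q q f u p G hsol hq hf hG hcl hA hE hC hD hF θ hθ hθ2
  refine key.trans (le_of_eq ?_)
  have e1 : (Real.toNNReal (cν * (cT * c1)) : ℝ≥0∞) = ENNReal.ofReal (cν * (cT * c1)) := rfl
  have e2 : (Real.toNNReal (cν * cT) : ℝ≥0∞) = ENNReal.ofReal (cν * cT) := rfl
  have e3 : (Real.toNNReal (cν * (2 * cT)) : ℝ≥0∞) = ENNReal.ofReal (cν * (2 * cT)) := rfl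
  have e4 : (Real.toNNReal (cν * (2 * cT * c2)) : ℝ≥0∞) = ENNReal.ofReal (cν * (2 * cT * c2)) := rfl
  rw [e1, e2, e3, e4, mul_add, mul_add, mul_add]
  have hθ0 : 0 ≤ θ ^ 2 := sq_nonneg θ
  have hθi2 : 0 ≤ (θ ^ 2)⁻¹ := inv_nonneg.2 hθ0
  have hθi : 0 ≤ θ⁻¹ := inv_nonneg.2 hθ.le
  have t1 : ENNReal.ofReal cν * (ENNReal.ofReal (cT * θ ^ 2 * c1) * cknC 1 0 u ^ (2 / 3 : ℝ)) =
      ENNReal.ofReal (cν * (cT * c1)) * ENNReal.ofReal (θ ^ 2) * cknC 1 0 u ^ (2 / 3 : ℝ) := by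
    rw [← mul_assoc, ← ENNReal.ofReal_mul hcν0, ← ENNReal.ofReal_mul (by positivity)]
    congr 2; ring
  have t2 : ENNReal.ofReal cν * (ENNReal.ofReal (cT * (θ ^ 2)⁻¹) * cknC 1 0 u) =
      ENNReal.ofReal (cν * cT) * ENNReal.ofReal ((θ ^ 2)⁻¹) * cknC 1 0 u := by
    rw [← mul_assoc, ← ENNReal.ofReal_mul hcν0, ← ENNReal.ofReal_mul (by positivity)]
    congr 2; ring
  have t3 : ENNReal.ofReal cν * (ENNReal.ofReal (2 * cT * (θ ^ 2)⁻¹) * cknD 1 0 p ^ (2 / 3 : ℝ) *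
      cknC 1 0 u ^ (1 / 3 : ℝ)) =
      ENNReal.ofReal (cν * (2 * cT)) * ENNReal.ofReal ((θ ^ 2)⁻¹) * cknD 1 0 p ^ (2 / 3 : ℝ) *
        cknC 1 0 u ^ (1 / 3 : ℝ) := by
    rw [← mul_assoc, ← mul_assoc, ← ENNReal.ofReal_mul hcν0, ← ENNReal.ofReal_mul (by positivity)]
    congr 3; ring
  have t4 : ENNReal.ofReal cν * (ENNReal.ofReal (2 * cT * c2 * θ⁻¹) * cknF q 1 0 f ^ (1 / q) *
      cknC 1 0 u ^ (1 / 3 : ℝ)) =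
      ENNReal.ofReal (cν * (2 * cT * c2)) * ENNReal.ofReal θ⁻¹ * cknF q 1 0 f ^ (1 / q) *
        cknC 1 0 u ^ (1 / 3 : ℝ) := by
    have hc2' : 0 ≤ c2 := by linarith
    rw [← mul_assoc, ← mul_assoc, ← ENNReal.ofReal_mul hcν0, ← ENNReal.ofReal_mul (by positivity)]
    congr 3; ring
  rw [t1, t2, t3, t4]

end UnitScale

/-! ### Every centre and scale -/

section Scaled

/-- **The absolute local-energy bound at two scales** (Lemarié-Rieusset, proof of Thm. 14.4,
scan p. 506, first display; here in the scaled backward-cylinder vocabulary of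
Caffarelli–Kohn–Nirenberg): for `ν > 0` there are constants `c₁, …, c₄` depending only on `ν`
such that for every suitable weak solution `(u, p)` with viscosity `ν` and force `f ∈ L^q(Q)`,
`q ≥ 3/2`, every weak spatial gradient `G` of `u` on `Q`, every cylinder with
`closure Q_R(z) ⊆ Q` and every `0 < θ ≤ 1/2`,
`A(θR) + E(θR) ≤ c₁ θ² C(R)^{2/3} + c₂ θ⁻² C(R) + c₃ θ⁻² D(R)^{2/3} C(R)^{1/3}
  + c₄ θ⁻¹ F_q(R)^{1/q} C(R)^{1/3}`
(`A = cknAEss`, `E = cknE`, `C = cknC`, `D = cknD`, `F_q = cknF q`). Only `C, D, F_q` of the large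
cylinder appear on the right. From the unit-scale bound by the Navier–Stokes scaling
(Caffarelli–Kohn–Nirenberg 1982, §2). [cite: Lemarierieusset2023, §14.3 proof of Thm. 14.4, display before (14.19) (scan p. 506)] -/
theorem localEnergyBound {ν : ℝ} (hν : 0 < ν) :
    ∃ c₁ c₂ c₃ c₄ : ℝ≥0, ∀ (Q : Opens (ℝ × EuclideanSpace ℝ (Fin 3))) (q : ℝ)
      (f u : ℝ → EuclideanSpace ℝ (Fin 3) → EuclideanSpace ℝ (Fin 3))
      (p : ℝ → EuclideanSpace ℝ (Fin 3) → ℝ)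
      (G : ℝ → EuclideanSpace ℝ (Fin 3) → EuclideanSpace ℝ (Fin 3) →L[ℝ] EuclideanSpace ℝ (Fin 3)),
      IsSuitableWeakSolutionOn Q ν f u p → 3 / 2 ≤ q →
      MemLp (uncurry f) (ENNReal.ofReal q)
        (volume.restrict (Q : Set (ℝ × EuclideanSpace ℝ (Fin 3)))) →
      HasWeakSpatialGradientOn Q u G →
      ∀ (z : ℝ × EuclideanSpace ℝ (Fin 3)) (R θ : ℝ), 0 < R → 0 < θ → θ ≤ 1 / 2 →
        closure (parabolicCylinder R z) ⊆ (Q : Set (ℝ × EuclideanSpace ℝ (Fin 3))) →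
        cknAEss (θ * R) z u + cknE (θ * R) z G ≤
          c₁ * ENNReal.ofReal (θ ^ 2) * cknC R z u ^ (2 / 3 : ℝ) +
          c₂ * ENNReal.ofReal ((θ ^ 2)⁻¹) * cknC R z u +
          c₃ * ENNReal.ofReal ((θ ^ 2)⁻¹) * cknD R z p ^ (2 / 3 : ℝ) * cknC R z u ^ (1 / 3 : ℝ) +
          c₄ * ENNReal.ofReal θ⁻¹ * cknF q R z f ^ (1 / q) * cknC R z u ^ (1 / 3 : ℝ) := by
  obtain ⟨c₁, c₂, c₃, c₄, H⟩ := localEnergyBound_unitScale hν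
  refine ⟨c₁, c₂, c₃, c₄, fun Q q f u p G hsol hq hf hG z r θ hr hθ hθ' hcl => ?_⟩
  have hq0 : 0 ≤ q := by linarith
  -- the zoomed data
  set Q' := stPreimage (r ^ 2) r z.1 z.2 Q with hQ'
  set u' := r • stPull (r ^ 2) r z.1 z.2 u with hu'
  set p' := r ^ 2 • stPull (r ^ 2) r z.1 z.2 p with hp'
  set f' := r ^ 3 • stPull (r ^ 2) r z.1 z.2 f with hf'
  set G' := r ^ 2 • stPull (r ^ 2) r z.1 z.2 G with hG'
  have hsol' : IsSuitableWeakSolutionOn Q' ν f' u' p' := by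
    have := hsol.stRescale (α := r) (β := r ^ 2) (γ := r) hr hr (by ring) z.1 z.2
    rwa [show r * ν / r = ν by field_simp, show r ^ 2 * r = r ^ 3 by ring] at this
  have hf'' : MemLp (uncurry f') (ENNReal.ofReal q)
      (volume.restrict (Q' : Set (ℝ × EuclideanSpace ℝ (Fin 3)))) :=
    hf.smul_uncurry_stPull (by positivity) hr z.1 z.2 (r ^ 3)
  have hG'' : HasWeakSpatialGradientOn Q' u' G' := by
    have := hG.stRescale r (by positivity : 0 < r ^ 2) hr z.1 z.2
    rwa [← sq] at this
  have hcl' := closure_parabolicCylinder_one_subset_stPreimage hr hcl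
  have key := H Q' q f' u' p' G' hsol' hq hf'' hG'' hcl' θ hθ hθ'
  -- transport the quantities back
  have hz : stAffine (r ^ 2) r z.1 z.2 (0 : ℝ × EuclideanSpace ℝ (Fin 3)) = z :=
    Prod.ext (by simp [stAffine]) (by simp [stAffine])
  have hA : ∀ ρ : ℝ, 0 < ρ → cknAEss ρ 0 u' = cknAEss (ρ * r) z u := fun ρ hρ => by
    rw [hu', cknAEss_nsZoom hr hρ z.1 z.2 0 u, hz, mul_comm]
  have hE : ∀ ρ : ℝ, 0 < ρ → cknE ρ 0 G' = cknE (ρ * r) z G := fun ρ hρ => by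
    rw [hG', cknE_nsZoom hr hρ z.1 z.2 0 G, hz, mul_comm]
  have hC : cknC 1 0 u' = cknC r z u := by
    rw [hu', cknC_nsZoom hr one_pos z.1 z.2 0 u, hz, mul_one]
  have hD : cknD 1 0 p' = cknD r z p := by
    rw [hp', cknD_nsZoom hr one_pos z.1 z.2 0 p, hz, mul_one]
  have hF : cknF q 1 0 f' = cknF q r z f := by
    rw [hf', cknF_nsZoom hr one_pos hq0 z.1 z.2 0 f, hz, mul_one]
  rw [hA θ hθ, hE θ hθ, hC, hD, hF] at key
  exact key

end Scaled

end Literature.Analysis.FluidPDE
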